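import Literature.RepresentationTheory.FiniteMonoids.InverseMonoidAlgebras
import Mathlib.LinearAlgebra.FiniteDimensional.Basic
import Mathlib.RingTheory.Artinian.Module
import Mathlib.RingTheory.Jacobson.Semiprimary
import Mathlib.Data.Complex.BigOperators
import HarnessLib

/-!
# `kL ≅ k^L` for finite lattices and `ℂM` semisimple for inverse monoids (Steinberg 2016, Ch. 9)

Topic `Literature/RepresentationTheory/FiniteMonoids`. This file proves the two named facts of
`InverseMonoidAlgebras.lean` (B. Steinberg, *Representation Theory of Finite Monoids*,
Universitext, Springer 2016):

* `Steinberg2016_9_5` (ibid. Cor. 9.5, after L. Solomon 1967): for every field `k` and every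
  finite commutative monoid `L` in which every element is idempotent (= a finite lattice under
  meet, ibid. Prop. 2.1), `MonoidAlgebra k L ≃ₐ[k] (L → k)` — `theorem Steinberg2016_9_5_holds`;
* `Steinberg2016_9_4_complex` (ibid. Cor. 9.4 with §9.3: for a finite inverse monoid `M`, `ℂM` is
  semisimple) — `theorem Steinberg2016_9_4_complex_holds`.

It contains only the proofs and their lemmas; no new definitions or named facts.

## Discharge of `Steinberg2016_9_5` (Steinberg 2016, Cor. 9.5, via Thm. 9.3 and Prop. 2.1)

We follow the book. By Prop. 2.1 the natural partial order of a finite commutative monoid `L` in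
which every element is idempotent is `y ≤ x ↔ y x = y`, and the product is the meet. The
isomorphism of Thm. 9.3, `α : kM → kG(M)`, `α(m) = Σ_{n ≤ m} [n]`, specialises for a lattice
(proof of Cor. 9.5: "The groupoid `G(L)` consists of just the identities `[x]` … and so
`kG(L) ≅ k^L`", pointwise product) to the *zeta transform*
`α(x) = χ_{↓x} = (y ↦ [y ≤ x]) ∈ k^L`, which is multiplicative because
`↓x ∩ ↓x' = ↓(x x')` — the product is the meet (`mul_mul_eq_self_iff`). The book inverts `α`
explicitly with the Möbius function, `β([x]) = Σ_{y ≤ x} μ(y, x) y`; we take the shorter Mathlib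
road to bijectivity: `α` is onto because `δ_x = χ_{↓x} - Σ_{y < x} δ_y` lies in its range by
well-founded induction on `<` (unitriangularity of the zeta matrix, `zeta_eq_single_add`,
`single_mem_range_zeta`), and a surjective `k`-linear endomorphism of the finite-dimensional
space `k^L ≃ₗ kL` is injective (`zeta_injective`). The lemmas are stated for any monoid
homomorphism `φ : L →* k^L` with `φ x y = [y x = y]` (hypothesis `hφ`); the homomorphism itself
is built inside `Steinberg2016_9_5_holds`, so this discharge adds no definitions.

## Discharge of `Steinberg2016_9_4_complex` (Steinberg 2016, Cor. 9.4 / §9.3, via Exercise 9.7)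

Steinberg's printed proof of Cor. 9.4 runs through the Möbius isomorphism `kM ≅ kG(M)` with the
groupoid algebra (Thm. 9.3, Lemma 3.16), the block decomposition of a groupoid algebra
(Thm. 8.15), Maschke's theorem and Morita invariance of semisimplicity — none of which Mathlib
has. For the characteristic-zero consequence recorded in `Steinberg2016_9_4_complex` the book
itself offers a second, much shorter road, Exercise 9.7 (ibid., §9.5: `*`-representations of an
inverse monoid, "(v) Give another proof that `ℂM` is a semisimple algebra"), i.e. the classical
`*`-algebra argument (Munn, Oganesyan, Ponizovskiĭ), and that is the road formalized below:

1. *Inverse-monoid identities* (ibid., Thm. 3.2 "A monoid `M` is an inverse monoid if and only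
   if it is regular and its idempotents commute" — we need the forward direction, proved exactly
   as printed via `x = f (ef)* e` — and Cor. 3.4: `(m*)* = m`, `(mn)* = n* m*`):
   `InverseMonoidAlgebra.idem_comm`, `InverseMonoidAlgebra.inv_inv`,
   `InverseMonoidAlgebra.inv_mul`.
2. *The involution* `(Σ c_m m)⋆ = Σ conj(c_m) m*` of `ℂM` is additive, anti-multiplicative and
   involutive (`st_add`, `st_mul`, `st_st`; Exercise 9.7(b)(ii)–(iii) in coordinates).
3. *Positivity* (`star_mul_self_ne_zero`, the coordinate form of the faithfulness of the
   Preston–Wagner `*`-representation on `ℓ₂M`, Exercise 9.7(b)(iv)): if `a ≠ 0` then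
   `a⋆ a ≠ 0`. Pick `m₀` in the support of `a` whose domain idempotent `e = m₀* m₀` has the
   most fixed points `#{y | e y = y}` (i.e. `e` is maximal in the natural partial order among the
   domain idempotents of the support). If `m, n` lie in the support and `m* n = e` then
   `e ≤ n* n`, `e ≤ m* m`, so by maximality `m* m = n* n = e`, and then `m = (m m*) n`,
   `n = (n n*) m` force `m = n` (commuting idempotents). Hence the coefficient of `a⋆ a` at `e`
   is `Σ_{m* m = e} |c_m|² > 0`.
4. *Semisimplicity from a positive involution* (`isSemisimpleRing_of_star_mul_self`,
   Exercise 9.7(a),(v) in ring-theoretic form): `ℂM` is finite-dimensional, hence artinian, so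
   its Jacobson radical `J` is nilpotent (`IsSemiprimaryRing.isNilpotent`); for `a ∈ J` the
   self-adjoint `b = a⋆ a ∈ J` satisfies `b^{2^k} ≠ 0` for all `k` by positivity unless
   `a = 0`; so `J = 0` and an artinian ring with zero radical is semisimple
   (`IsArtinianRing.isSemisimpleRing_iff_jacobson`).

All intermediate results are theorems of this file (no new definitions: the inverse `m ↦ m*`
enters as a function `s` with its three defining properties, obtained by `choose` from
`IsInverseMonoid M`, and the involution `⋆` as a function `st` with its defining formula).

Mathlib used: `MonoidAlgebra.induction_linear`, `MonoidAlgebra.single_mul_single`,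
`MonoidAlgebra.sum_coeff_single`, `Finset.exists_max_image`, `Finset.eq_of_subset_of_card_le`,
`IsArtinianRing.of_finite`, `IsSemiprimaryRing.isNilpotent`,
`IsArtinianRing.isSemisimpleRing_iff_jacobson`. Deliberately NOT here: the block decomposition
`kM ≅ ∏ M_{nᵢ}(kG_{eᵢ})` of Cor. 9.4 and the positive-characteristic half of its "if and only if".

## References

* B. Steinberg, *Representation Theory of Finite Monoids*, Universitext, Springer (2016):
  Prop. 2.1, Thm. 9.3, Cor. 9.5 (for `Steinberg2016_9_5`); §3.1, Thm. 3.2 (idempotents of an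
  inverse monoid commute), Cor. 3.4 (`(m*)* = m`, `(mn)* = n* m*`), Lemma 3.8 / Prop. 3.9
  (natural partial order), Cor. 9.4, §9.3 (first sentence), Exercise 9.7 (`*`-representations;
  "(v) Give another proof that `ℂM` is a semisimple algebra") (for `Steinberg2016_9_4_complex`).
* L. Solomon, *The Burnside algebra of a finite group*, J. Combinatorial Theory 2 (1967) 603–615.
-/

namespace Literature.RepresentationTheory.FiniteMonoids

section Steinberg2016_9_5_proof

variable {k : Type} [Field k] {L : Type} [CommMonoid L]

/-- In a commutative monoid in which every element is idempotent, `y ≤ x x'` iff `y ≤ x` and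
`y ≤ x'` for the natural partial order `y ≤ x ↔ y x = y`, i.e. `x x' = x ∧ x'` (Steinberg 2016,
proof of Prop. 2.1: "if `m ≤ e, f`, then `efm = mef = mf = m` and so `m ≤ ef`. Thus
`ef = e ∧ f`"). [cite: Steinberg2016, Prop. 2.1] -/
private theorem mul_mul_eq_self_iff (hid : ∀ x : L, x * x = x) (y x x' : L) :
    y * (x * x') = y ↔ y * x = y ∧ y * x' = y := by
  refine ⟨fun h => ⟨?_, ?_⟩, fun h => by rw [← mul_assoc, h.1, h.2]⟩
  · have h' : y * (x * x') * x = y * (x * x') := by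
      rw [mul_assoc, mul_right_comm x x' x, hid x]
    rwa [h] at h'
  · have h' : y * (x * x') * x' = y * (x * x') := by
      rw [mul_assoc, mul_assoc x x' x', hid x']
    rwa [h] at h'

/-- The strict natural order `y < x ↔ (y x = y ∧ y ≠ x)` of a finite commutative monoid is well
founded (it is transitive and irreflexive on a finite set; Steinberg 2016, Prop. 2.1: "the order
is the natural partial order"). [cite: Steinberg2016, Prop. 2.1] -/
private theorem wellFounded_mul_eq_self_and_ne [Finite L] :
    WellFounded (fun y x : L => y * x = y ∧ y ≠ x) := by
  haveI : IsTrans L (fun y x : L => y * x = y ∧ y ≠ x) :=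
    ⟨fun a b c hab hbc =>
      ⟨calc a * c = a * b * c := by rw [hab.1]
          _ = a * (b * c) := mul_assoc a b c
          _ = a := by rw [hbc.1, hab.1],
        fun h => hbc.2
          (calc b = b * c := hbc.1.symm
            _ = c * b := mul_comm b c
            _ = a * b := by rw [h]
            _ = a := hab.1
            _ = c := h)⟩⟩
  haveI : Std.Irrefl (fun y x : L => y * x = y ∧ y ≠ x) := ⟨fun a h => h.2 rfl⟩
  exact Finite.wellFounded_of_trans_of_irrefl _

variable [Fintype L] [DecidableEq L] (φ : L →* (L → k))

/-- Unitriangularity of the zeta transform `φ : x ↦ χ_{↓x}` (Steinberg 2016, Thm. 9.3: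
`α(m) = Σ_{n ≤ m} [n]`): `χ_{↓x} = δ_x + Σ_{y < x} δ_y` in `k^L`.
[cite: Steinberg2016, Thm. 9.3] -/
private theorem zeta_eq_single_add (hid : ∀ x : L, x * x = x)
    (hφ : ∀ x y : L, φ x y = if y * x = y then 1 else 0) (x : L) :
    (φ x : L → k) =
      Pi.single x 1 + ∑ y ∈ Finset.univ.filter (fun y => y * x = y ∧ y ≠ x), Pi.single y 1 := by
  funext z
  rw [hφ, Pi.add_apply, Finset.sum_apply]
  simp only [Pi.single_apply, Finset.sum_ite_eq, Finset.mem_filter, Finset.mem_univ, true_and]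
  by_cases hz : z = x
  · subst hz
    simp [hid]
  · simp [hz]

/-- Surjectivity of the zeta transform on basis vectors (the triangular inversion behind
Steinberg 2016, Thm. 9.3, `β = α⁻¹`): every `δ_x ∈ k^L` lies in the range of the extension
`kL → k^L` of `φ : x ↦ χ_{↓x}`, by well-founded induction on the natural order, since
`δ_x = χ_{↓x} - Σ_{y < x} δ_y`. [cite: Steinberg2016, Thm. 9.3] -/
private theorem single_mem_range_zeta (hid : ∀ x : L, x * x = x)
    (hφ : ∀ x y : L, φ x y = if y * x = y then 1 else 0) (x : L) :
    (Pi.single x 1 : L → k) ∈ (MonoidAlgebra.lift k (L → k) L φ).range := by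
  refine (wellFounded_mul_eq_self_and_ne (L := L)).induction
    (C := fun x => (Pi.single x 1 : L → k) ∈ (MonoidAlgebra.lift k (L → k) L φ).range)
    x (fun x ih => ?_)
  have hx : (Pi.single x 1 : L → k) =
      MonoidAlgebra.lift k (L → k) L φ (MonoidAlgebra.of k L x) -
        ∑ y ∈ Finset.univ.filter (fun y => y * x = y ∧ y ≠ x), Pi.single y 1 := by
    rw [MonoidAlgebra.lift_of, zeta_eq_single_add φ hid hφ x, add_sub_cancel_right]
  rw [hx]
  refine Subalgebra.sub_mem _ (AlgHom.mem_range_self _ _)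
    (Subalgebra.sum_mem _ fun y hy => ih y ?_)
  simpa using hy

/-- The extension `kL → k^L` of the zeta transform `φ : x ↦ χ_{↓x}` (Steinberg 2016, Thm. 9.3 for
a lattice) is surjective. [cite: Steinberg2016, Thm. 9.3] -/
private theorem zeta_surjective (hid : ∀ x : L, x * x = x)
    (hφ : ∀ x y : L, φ x y = if y * x = y then 1 else 0) :
    Function.Surjective (MonoidAlgebra.lift k (L → k) L φ) := by
  intro f
  have hf : f ∈ (MonoidAlgebra.lift k (L → k) L φ).range := by
    rw [← Finset.univ_sum_single f]
    refine Subalgebra.sum_mem _ fun x _ => ?_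
    have hfx : (Pi.single x (f x) : L → k) = f x • (Pi.single x 1 : L → k) := by
      rw [← Pi.single_smul', smul_eq_mul, mul_one]
    rw [hfx]
    exact Subalgebra.smul_mem _ (single_mem_range_zeta φ hid hφ x) (f x)
  exact ((MonoidAlgebra.lift k (L → k) L φ).mem_range).mp hf

/-- The extension `kL → k^L` of the zeta transform `φ : x ↦ χ_{↓x}` (Steinberg 2016, Thm. 9.3
for a lattice) is injective: a surjective linear endomorphism of the finite-dimensional space
`k^L ≃ₗ[k] kL` is injective. [cite: Steinberg2016, Thm. 9.3] -/
private theorem zeta_injective (hid : ∀ x : L, x * x = x)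
    (hφ : ∀ x y : L, φ x y = if y * x = y then 1 else 0) :
    Function.Injective (MonoidAlgebra.lift k (L → k) L φ) := by
  set Φ := MonoidAlgebra.lift k (L → k) L φ
  let e : MonoidAlgebra k L ≃ₗ[k] (L → k) := (MonoidAlgebra.basis L k).equivFun
  have h1 : Function.Surjective (Φ.toLinearMap ∘ₗ e.symm.toLinearMap) :=
    (zeta_surjective φ hid hφ).comp e.symm.surjective
  have h2 : Function.Injective (Φ.toLinearMap ∘ₗ e.symm.toLinearMap) :=
    LinearMap.injective_iff_surjective.mpr h1
  have h3 : Function.Injective ((Φ.toLinearMap ∘ₗ e.symm.toLinearMap) ∘ e) :=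
    h2.comp e.injective
  intro a b hab
  apply h3
  simpa using hab

end Steinberg2016_9_5_proof

/-- **Discharge of `Steinberg2016_9_5`** (Steinberg 2016, Cor. 9.5, after Solomon 1967: "Let `L`
be a finite lattice and `k` a field. Then `kL ≅ k^L`"; Prop. 2.1: finite lattices = finite
commutative monoids of idempotents under meet). The isomorphism is the extension to `kL` of the
zeta transform `x ↦ χ_{↓x}`, `χ_{↓x}(y) = [y x = y]`, of Thm. 9.3 (a monoid homomorphism
`L →* k^L` by `mul_mul_eq_self_iff`), bijective by `zeta_injective` / `zeta_surjective`.
[cite: Steinberg2016, Cor. 9.5] -/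
theorem Steinberg2016_9_5_holds : Steinberg2016_9_5 := by
  intro k _ L _ _ hid
  classical
  let φ : L →* (L → k) :=
    { toFun := fun x y => if y * x = y then 1 else 0
      map_one' := by
        funext y
        simp
      map_mul' := fun x x' => by
        funext y
        simp only [Pi.mul_apply, mul_mul_eq_self_iff hid]
        by_cases hx : y * x = y <;> by_cases hx' : y * x' = y <;> simp [hx, hx'] }
  have hφ : ∀ x y : L, φ x y = if y * x = y then 1 else 0 := fun _ _ => rfl
  exact ⟨AlgEquiv.ofBijective (MonoidAlgebra.lift k (L → k) L φ)
    ⟨zeta_injective φ hid hφ, zeta_surjective φ hid hφ⟩⟩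

section Steinberg2016_9_4_complex_proof

open ComplexConjugate

namespace InverseMonoidAlgebra

section InverseMonoidIdentities

variable {M : Type*} [Monoid M] {s : M → M}

/-- In an inverse monoid `e* = e` for every idempotent `e` ("because `eee = e`", Steinberg 2016,
proof of Thm. 3.2). [cite: Steinberg2016, Thm. 3.2 (proof)] -/
theorem inv_of_idem (h3 : ∀ m n : M, m * n * m = m → n * m * n = n → n = s m) {e : M}
    (he : e * e = e) : s e = e :=
  (h3 e e (by rw [he, he]) (by rw [he, he])).symm

/-- `(m*)* = m` (Steinberg 2016, Cor. 3.4(i)). [cite: Steinberg2016, Cor. 3.4(i)] -/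
theorem inv_inv (h1 : ∀ m : M, m * s m * m = m) (h2 : ∀ m : M, s m * m * s m = s m)
    (h3 : ∀ m n : M, m * n * m = m → n * m * n = n → n = s m) (m : M) : s (s m) = m :=
  (h3 (s m) m (h2 m) (h1 m)).symm

/-- `m* m` is idempotent. [cite: Steinberg2016, §3.1] -/
theorem idem_inv_mul (h2 : ∀ m : M, s m * m * s m = s m) (m : M) :
    s m * m * (s m * m) = s m * m := by
  rw [← mul_assoc, h2]

/-- `m m*` is idempotent. [cite: Steinberg2016, §3.1] -/
theorem idem_mul_inv (h1 : ∀ m : M, m * s m * m = m) (m : M) :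
    m * s m * (m * s m) = m * s m := by
  rw [← mul_assoc, h1]

/-- The product of two idempotents of an inverse monoid is idempotent (Steinberg 2016, proof of
Thm. 3.2: with `x = f (ef)* e` one checks `x² = x`, `x (ef) x = x`, `(ef) x (ef) = ef`, whence
`ef = x* = x`). [cite: Steinberg2016, Thm. 3.2 (proof)] -/
theorem idem_mul_idem (h1 : ∀ m : M, m * s m * m = m) (h2 : ∀ m : M, s m * m * s m = s m)
    (h3 : ∀ m n : M, m * n * m = m → n * m * n = n → n = s m) {e f : M} (he : e * e = e)
    (hf : f * f = f) : e * f * (e * f) = e * f := by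
  set x := f * s (e * f) * e with hx
  have hx2 : x * x = x := by
    have : x * x = f * (s (e * f) * (e * f) * s (e * f)) * e := by simp only [hx, mul_assoc]
    rw [this, h2]
  have hxef : x * (e * f) * x = x := by
    have : x * (e * f) * x = f * (s (e * f) * ((e * e) * (f * f)) * s (e * f)) * e := by
      simp only [hx, mul_assoc]
    rw [this, he, hf, h2]
  have hefx : e * f * x * (e * f) = e * f := by
    have : e * f * x * (e * f) = e * (f * f) * s (e * f) * ((e * e) * f) := by
      simp only [hx, mul_assoc]
    rw [this, he, hf, h1]
  have hef : e * f = x := by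
    rw [h3 x (e * f) hxef hefx, inv_of_idem h3 hx2]
  rw [hef, hx2]

/-- **Idempotents of an inverse monoid commute** (Munn–Penrose; Steinberg 2016, Thm. 3.2,
forward direction, proved as printed: `ef` and `fe` are idempotents with `(ef)(fe)(ef) = ef`,
`(fe)(ef)(fe) = fe`, so `fe = (ef)* = ef`). [cite: Steinberg2016, Thm. 3.2] -/
theorem idem_comm (h1 : ∀ m : M, m * s m * m = m) (h2 : ∀ m : M, s m * m * s m = s m)
    (h3 : ∀ m n : M, m * n * m = m → n * m * n = n → n = s m) {e f : M} (he : e * e = e)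
    (hf : f * f = f) : e * f = f * e := by
  have hef := idem_mul_idem h1 h2 h3 he hf
  have hfe := idem_mul_idem h1 h2 h3 hf he
  have k1 : e * f * (f * e) * (e * f) = e * f := by
    have : e * f * (f * e) * (e * f) = e * (f * f) * (e * e) * f := by simp only [mul_assoc]
    rw [this, hf, he]
    have : e * f * e * f = e * f * (e * f) := by simp only [mul_assoc]
    rw [this, hef]
  have k2 : f * e * (e * f) * (f * e) = f * e := by
    have : f * e * (e * f) * (f * e) = f * (e * e) * (f * f) * e := by simp only [mul_assoc]
    rw [this, he, hf]
    have : f * e * f * e = f * e * (f * e) := by simp only [mul_assoc]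
    rw [this, hfe]
  rw [h3 (e * f) (f * e) k1 k2, inv_of_idem h3 hef]

/-- `(mn)* = n* m*` (Steinberg 2016, Cor. 3.4(iii), proved as printed:
`mn (n* m*) mn = m m* m n n* n = mn` and `n* m* (mn) n* m* = n* m*`, using that the idempotents
`m* m`, `n n*` commute). [cite: Steinberg2016, Cor. 3.4(iii)] -/
theorem inv_mul (h1 : ∀ m : M, m * s m * m = m) (h2 : ∀ m : M, s m * m * s m = s m)
    (h3 : ∀ m n : M, m * n * m = m → n * m * n = n → n = s m) (m n : M) :
    s (m * n) = s n * s m := by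
  have hc : n * s n * (s m * m) = s m * m * (n * s n) :=
    idem_comm h1 h2 h3 (idem_mul_inv h1 n) (idem_inv_mul h2 m)
  symm
  apply h3
  · have : m * n * (s n * s m) * (m * n) = m * (n * s n * (s m * m)) * n := by
      simp only [mul_assoc]
    rw [this, hc]
    have : m * (s m * m * (n * s n)) * n = (m * s m * m) * (n * s n * n) := by
      simp only [mul_assoc]
    rw [this, h1, h1]
  · have : s n * s m * (m * n) * (s n * s m) = s n * (s m * m * (n * s n)) * s m := by
      simp only [mul_assoc]
    rw [this, ← hc]
    have : s n * (n * s n * (s m * m)) * s m = (s n * n * s n) * (s m * m * s m) := by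
      simp only [mul_assoc]
    rw [this, h2, h2]

/-- Maximality step of the positivity argument. Order idempotents by `e ≤ d ⟺ e d = e` and
measure an idempotent `d` by its number of fixed points `#{y | d y = y}` (monotone, and strictly
so: `e ≤ d` with equally many fixed points forces `d = e`). If `m* n = m₀* m₀ =: e` then
`e ≤ n* n`; so if `n* n` has at most as many fixed points as `e`, then `n* n = e`.
[cite: Steinberg2016, Exercise 9.7(b)] -/
theorem inv_mul_self_eq_of_card_le [Fintype M] [DecidableEq M] (h1 : ∀ m : M, m * s m * m = m)
    (h2 : ∀ m : M, s m * m * s m = s m) (h3 : ∀ m n : M, m * n * m = m → n * m * n = n → n = s m)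
    {m n m₀ : M}
    (hn : (Finset.univ.filter fun y => s n * n * y = y).card ≤
      (Finset.univ.filter fun y => s m₀ * m₀ * y = y).card)
    (h : s m * n = s m₀ * m₀) : s n * n = s m₀ * m₀ := by
  have he : s m₀ * m₀ * (s m₀ * m₀) = s m₀ * m₀ := idem_inv_mul h2 m₀
  have hd : s n * n * (s n * n) = s n * n := idem_inv_mul h2 n
  have hed : s m₀ * m₀ * (s n * n) = s m₀ * m₀ := by
    rw [← h]
    have : s m * n * (s n * n) = s m * (n * s n * n) := by simp only [mul_assoc]
    rw [this, h1]
  have hde : s n * n * (s m₀ * m₀) = s m₀ * m₀ := by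
    rw [idem_comm h1 h2 h3 hd he, hed]
  have hsub : (Finset.univ.filter fun y => s m₀ * m₀ * y = y) ⊆
      (Finset.univ.filter fun y => s n * n * y = y) := by
    intro y hy
    simp only [Finset.mem_filter, Finset.mem_univ, true_and] at hy ⊢
    rw [← hy, ← mul_assoc, hde]
  have heq := Finset.eq_of_subset_of_card_le hsub hn
  have hmem : s n * n ∈ (Finset.univ.filter fun y => s n * n * y = y) := by
    simp only [Finset.mem_filter, Finset.mem_univ, true_and]
    exact hd
  rw [← heq] at hmem
  simp only [Finset.mem_filter, Finset.mem_univ, true_and] at hmem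
  rw [← hmem, hed]

/-- The key combinatorial fact behind positivity: if `m* n = m₀* m₀ =: e` where neither `m* m`
nor `n* n` has more fixed points than `e`, then `m = n` and `m* m = e`. (By the previous lemma
`n* n = e = m* m`; then `m = (m m*) n` and `n = (n n*) m` with commuting idempotents `m m*`,
`n n*`, whence `m = n` — antisymmetry of the natural partial order, Steinberg 2016, Prop. 3.9.)
[cite: Steinberg2016, Prop. 3.9 and Exercise 9.7(b)] -/
theorem eq_of_inv_mul_eq [Fintype M] [DecidableEq M] (h1 : ∀ m : M, m * s m * m = m)
    (h2 : ∀ m : M, s m * m * s m = s m) (h3 : ∀ m n : M, m * n * m = m → n * m * n = n → n = s m)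
    {m n m₀ : M}
    (hm : (Finset.univ.filter fun y => s m * m * y = y).card ≤
      (Finset.univ.filter fun y => s m₀ * m₀ * y = y).card)
    (hn : (Finset.univ.filter fun y => s n * n * y = y).card ≤
      (Finset.univ.filter fun y => s m₀ * m₀ * y = y).card)
    (h : s m * n = s m₀ * m₀) : m = n ∧ s m * m = s m₀ * m₀ := by
  have hdn : s n * n = s m₀ * m₀ := inv_mul_self_eq_of_card_le h1 h2 h3 hn h
  have h' : s n * m = s m₀ * m₀ := by
    have := congrArg s h
    rwa [inv_mul h1 h2 h3, inv_inv h1 h2 h3, inv_of_idem h3 (idem_inv_mul h2 m₀)] at this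
  have hdm : s m * m = s m₀ * m₀ := inv_mul_self_eq_of_card_le h1 h2 h3 hm h'
  refine ⟨?_, hdm⟩
  have hA : m = m * s m * n := by
    calc m = m * s m * m := (h1 m).symm
      _ = m * (s m * m) := mul_assoc _ _ _
      _ = m * (s m * n) := by rw [hdm, h]
      _ = m * s m * n := (mul_assoc _ _ _).symm
  have hB : n = n * s n * m := by
    calc n = n * s n * n := (h1 n).symm
      _ = n * (s n * n) := mul_assoc _ _ _
      _ = n * (s n * m) := by rw [hdn, h']
      _ = n * s n * m := (mul_assoc _ _ _).symm
  have hcomm : m * s m * (n * s n) = n * s n * (m * s m) :=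
    idem_comm h1 h2 h3 (idem_mul_inv h1 m) (idem_mul_inv h1 n)
  calc m = m * s m * n := hA
    _ = m * s m * (n * s n * m) := congrArg (m * s m * ·) hB
    _ = (m * s m * (n * s n)) * m := by simp only [mul_assoc]
    _ = (n * s n * (m * s m)) * m := by rw [hcomm]
    _ = n * s n * (m * s m * m) := by simp only [mul_assoc]
    _ = n * s n * m := by rw [h1]
    _ = n := hB.symm

end InverseMonoidIdentities

section StarBasics

variable {M : Type*} {s : M → M} {st : MonoidAlgebra ℂ M → MonoidAlgebra ℂ M}

/-- The involution `⋆` on a basis vector: `(c m)⋆ = conj(c) m*`. [cite: Steinberg2016,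
Exercise 9.7(b)] -/
theorem st_single
    (hst : ∀ a, st a = a.coeff.sum fun m c => MonoidAlgebra.single (s m) (conj c))
    (m : M) (c : ℂ) : st (MonoidAlgebra.single m c) = MonoidAlgebra.single (s m) (conj c) := by
  rw [hst, MonoidAlgebra.coeff_single, Finsupp.sum_single_index]
  rw [map_zero, MonoidAlgebra.single_zero]

/-- `⋆` is additive. [cite: Steinberg2016, Exercise 9.7(b)] -/
theorem st_add
    (hst : ∀ a, st a = a.coeff.sum fun m c => MonoidAlgebra.single (s m) (conj c))
    (x y : MonoidAlgebra ℂ M) : st (x + y) = st x + st y := by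
  classical
  rw [hst, hst, hst, MonoidAlgebra.coeff_add, Finsupp.sum_add_index']
  · intro m
    rw [map_zero, MonoidAlgebra.single_zero]
  · intro m c₁ c₂
    rw [map_add, MonoidAlgebra.single_add]

/-- `0⋆ = 0`. [cite: Steinberg2016, Exercise 9.7(b)] -/
theorem st_zero
    (hst : ∀ a, st a = a.coeff.sum fun m c => MonoidAlgebra.single (s m) (conj c)) :
    st 0 = 0 := by
  rw [hst, MonoidAlgebra.coeff_zero, Finsupp.sum_zero_index]

end StarBasics

section Star

variable {M : Type*} [Monoid M] {s : M → M} {st : MonoidAlgebra ℂ M → MonoidAlgebra ℂ M}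

/-- `⋆` is anti-multiplicative: `(xy)⋆ = y⋆ x⋆` (from `(mn)* = n* m*`, Cor. 3.4(iii)).
[cite: Steinberg2016, Cor. 3.4(iii) and Exercise 9.7(b)(iii)] -/
theorem st_mul (h1 : ∀ m : M, m * s m * m = m) (h2 : ∀ m : M, s m * m * s m = s m)
    (h3 : ∀ m n : M, m * n * m = m → n * m * n = n → n = s m)
    (hst : ∀ a, st a = a.coeff.sum fun m c => MonoidAlgebra.single (s m) (conj c))
    (x y : MonoidAlgebra ℂ M) : st (x * y) = st y * st x := by
  induction x using MonoidAlgebra.induction_linear with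
  | zero => rw [zero_mul, st_zero hst, mul_zero]
  | add x₁ x₂ hx₁ hx₂ => rw [add_mul, st_add hst, hx₁, hx₂, st_add hst, mul_add]
  | single m c =>
    induction y using MonoidAlgebra.induction_linear with
    | zero => rw [mul_zero, st_zero hst, zero_mul]
    | add y₁ y₂ hy₁ hy₂ => rw [mul_add, st_add hst, hy₁, hy₂, st_add hst, add_mul]
    | single n d =>
      rw [MonoidAlgebra.single_mul_single, st_single hst, st_single hst, st_single hst,
        MonoidAlgebra.single_mul_single, inv_mul h1 h2 h3, map_mul, mul_comm (conj c)]

/-- `⋆` is an involution: `x⋆⋆ = x` (from `(m*)* = m`, Cor. 3.4(i)).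
[cite: Steinberg2016, Cor. 3.4(i) and Exercise 9.7(b)] -/
theorem st_st (h1 : ∀ m : M, m * s m * m = m) (h2 : ∀ m : M, s m * m * s m = s m)
    (h3 : ∀ m n : M, m * n * m = m → n * m * n = n → n = s m)
    (hst : ∀ a, st a = a.coeff.sum fun m c => MonoidAlgebra.single (s m) (conj c))
    (x : MonoidAlgebra ℂ M) : st (st x) = x := by
  induction x using MonoidAlgebra.induction_linear with
  | zero => rw [st_zero hst, st_zero hst]
  | add x₁ x₂ hx₁ hx₂ => rw [st_add hst, st_add hst, hx₁, hx₂]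
  | single m c => rw [st_single hst, st_single hst, inv_inv h1 h2 h3, starRingEnd_self_apply]

/-- **Positivity of the involution of `ℂM`** for a finite inverse monoid `M`: if `a ≠ 0` then
`a⋆ a ≠ 0`. With `m₀` in the support of `a` maximizing the number of fixed points of
`m₀* m₀ =: e`, the coefficient of `a⋆ a` at `e` is `Σ_{m : m* m = e} |a_m|² > 0`
(by `eq_of_inv_mul_eq`). This is the coordinate form of Exercise 9.7(b)(iv) of Steinberg 2016
(the Preston–Wagner `*`-representation `ℓ₂M` is the regular module, hence faithful).
[cite: Steinberg2016, Exercise 9.7(b)] -/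
theorem star_mul_self_ne_zero [Fintype M] (h1 : ∀ m : M, m * s m * m = m)
    (h2 : ∀ m : M, s m * m * s m = s m) (h3 : ∀ m n : M, m * n * m = m → n * m * n = n → n = s m)
    {a : MonoidAlgebra ℂ M} (ha : a ≠ 0) :
    (a.coeff.sum fun m c => MonoidAlgebra.single (s m) (conj c)) * a ≠ 0 := by
  classical
  set A := a.coeff.support with hA_def
  have hA : A.Nonempty :=
    Finsupp.support_nonempty_iff.mpr fun h => ha (MonoidAlgebra.coeff_eq_zero.mp h)
  obtain ⟨m₀, hm₀, hmax⟩ := Finset.exists_max_image A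
    (fun m => (Finset.univ.filter fun y => s m * m * y = y).card) hA
  -- the product as a double sum of basis vectors
  have hsum : (∑ n ∈ A, MonoidAlgebra.single n (a.coeff n)) = a :=
    MonoidAlgebra.sum_coeff_single a
  have hprod : (a.coeff.sum fun m c => MonoidAlgebra.single (s m) (conj c)) * a =
      ∑ m ∈ A, ∑ n ∈ A,
        MonoidAlgebra.single (s m * n) (conj (a.coeff m) * a.coeff n) := by
    calc (a.coeff.sum fun m c => MonoidAlgebra.single (s m) (conj c)) * a
        = (∑ m ∈ A, MonoidAlgebra.single (s m) (conj (a.coeff m))) *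
            ∑ n ∈ A, MonoidAlgebra.single n (a.coeff n) := by rw [hsum]; rfl
      _ = ∑ m ∈ A, ∑ n ∈ A, MonoidAlgebra.single (s m) (conj (a.coeff m)) *
            MonoidAlgebra.single n (a.coeff n) := Finset.sum_mul_sum _ _ _ _
      _ = _ := by simp only [MonoidAlgebra.single_mul_single]
  intro hzero
  have hcoeff := congrArg (fun x : MonoidAlgebra ℂ M => x.coeff (s m₀ * m₀)) hzero
  simp only [MonoidAlgebra.coeff_zero, Finsupp.coe_zero, Pi.zero_apply] at hcoeff
  rw [hprod] at hcoeff
  simp only [MonoidAlgebra.coeff_sum, Finsupp.finsetSum_apply, MonoidAlgebra.coeff_single,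
    Finsupp.single_apply] at hcoeff
  -- only the diagonal terms `n = m` with `m* m = e` survive
  have hinner : ∀ m ∈ A,
      (∑ n ∈ A, if s m * n = s m₀ * m₀ then conj (a.coeff m) * a.coeff n else 0) =
        if s m * m = s m₀ * m₀ then conj (a.coeff m) * a.coeff m else 0 := by
    intro m hm
    rw [Finset.sum_eq_single_of_mem m hm]
    intro n hn hnm
    exact if_neg fun h => hnm (eq_of_inv_mul_eq h1 h2 h3 (hmax m hm) (hmax n hn) h).1.symm
  rw [Finset.sum_congr rfl hinner, ← Finset.sum_filter] at hcoeff
  simp only [← Complex.normSq_eq_conj_mul_self] at hcoeff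
  rw [← Complex.ofReal_sum, Complex.ofReal_eq_zero] at hcoeff
  refine (Finset.sum_pos ?_ ⟨m₀, ?_⟩).ne' hcoeff
  · intro m hm
    rw [Finset.mem_filter] at hm
    exact Complex.normSq_pos.mpr (Finsupp.mem_support_iff.mp hm.1)
  · rw [Finset.mem_filter]
    exact ⟨hm₀, rfl⟩

end Star

/-- **Semisimplicity from a positive anti-involution** (Exercise 9.7(a),(v) of Steinberg 2016 in
ring-theoretic form; classical for `ℂG`): an artinian ring carrying a map `⋆` with
`(ab)⋆ = b⋆ a⋆`, `a⋆⋆ = a` and `a⋆ a = 0 ⇒ a = 0` is semisimple. Its Jacobson radical `J` is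
nilpotent (`IsSemiprimaryRing.isNilpotent`); for `0 ≠ a ∈ J`, `b = a⋆ a ∈ J` is non-zero and
self-adjoint, and inductively `b^{2^{k+1}} = (b^{2^k})⋆ b^{2^k} ≠ 0`, contradicting `b^N = 0`;
so `J = 0` and `IsArtinianRing.isSemisimpleRing_iff_jacobson` applies. [folklore] -/
theorem isSemisimpleRing_of_star_mul_self {R : Type*} [Ring R] [IsArtinianRing R] (st : R → R)
    (hmul : ∀ a b, st (a * b) = st b * st a) (hstst : ∀ a, st (st a) = a)
    (hpos : ∀ a, st a * a = 0 → a = 0) : IsSemisimpleRing R := by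
  refine IsArtinianRing.isSemisimpleRing_iff_jacobson.mpr
    ((Submodule.eq_bot_iff _).mpr fun a ha => ?_)
  obtain ⟨N, hN⟩ := IsSemiprimaryRing.isNilpotent (R := R)
  by_contra ha0
  set b := st a * a with hb
  have hbJ : b ∈ Ring.jacobson R := Ideal.mul_mem_left _ _ ha
  have hbst : st b = b := by rw [hb, hmul, hstst]
  have hb0 : b ≠ 0 := fun h => ha0 (hpos a h)
  have key : ∀ k : ℕ, st (b ^ 2 ^ k) = b ^ 2 ^ k ∧ b ^ 2 ^ k ≠ 0 := by
    intro k
    induction k with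
    | zero => exact ⟨by rw [pow_zero, pow_one]; exact hbst, by rw [pow_zero, pow_one]; exact hb0⟩
    | succ k ih =>
      have hpow : b ^ 2 ^ (k + 1) = b ^ 2 ^ k * b ^ 2 ^ k := by
        rw [pow_succ, pow_mul, sq]
      refine ⟨by rw [hpow, hmul, ih.1], fun h => ih.2 (hpos _ ?_)⟩
      rw [ih.1, ← hpow]
      exact h
  have hbN : b ^ N = 0 := by
    have : b ^ N ∈ Ring.jacobson R ^ N := Ideal.pow_mem_pow hbJ N
    rwa [hN, Ideal.zero_eq_bot, Ideal.mem_bot] at this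
  refine (key N).2 ?_
  rw [← Nat.sub_add_cancel (Nat.lt_two_pow_self (n := N)).le, pow_add, hbN, mul_zero]

end InverseMonoidAlgebra

/-- **The complex algebra of a finite inverse monoid is semisimple** — discharge of
`Steinberg2016_9_4_complex` (Steinberg 2016, Cor. 9.4 with §9.3: "Let `M` be a finite inverse
monoid. Then `ℂM` is semisimple by Corollary 9.4"), by the `*`-algebra route of ibid.
Exercise 9.7: choose the inverse `m ↦ m*` (`IsInverseMonoid`), form the conjugate-linear
anti-involution `(Σ c_m m)⋆ = Σ conj(c_m) m*` of `ℂM`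
(`InverseMonoidAlgebra.st_mul`, `InverseMonoidAlgebra.st_st`), which is positive
(`InverseMonoidAlgebra.star_mul_self_ne_zero`), and conclude with
`InverseMonoidAlgebra.isSemisimpleRing_of_star_mul_self` (`ℂM` is finite-dimensional, hence
artinian). [cite: Steinberg2016, Cor. 9.4, §9.3 and Exercise 9.7] -/
theorem Steinberg2016_9_4_complex_holds : Steinberg2016_9_4_complex := by
  intro M _ _ hM
  classical
  have hM' : ∀ m : M, ∃ n : M, (m * n * m = m ∧ n * m * n = n) ∧
      ∀ y : M, m * y * m = m ∧ y * m * y = y → y = n := hM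
  choose s hs using hM'
  have h1 : ∀ m : M, m * s m * m = m := fun m => (hs m).1.1
  have h2 : ∀ m : M, s m * m * s m = s m := fun m => (hs m).1.2
  have h3 : ∀ m n : M, m * n * m = m → n * m * n = n → n = s m :=
    fun m n hmn hnm => (hs m).2 n ⟨hmn, hnm⟩
  haveI : Module.Finite ℂ (MonoidAlgebra ℂ M) := Module.Finite.of_basis (MonoidAlgebra.basis M ℂ)
  haveI : IsArtinianRing (MonoidAlgebra ℂ M) := IsArtinianRing.of_finite ℂ (MonoidAlgebra ℂ M)
  refine InverseMonoidAlgebra.isSemisimpleRing_of_star_mul_self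
    (fun a : MonoidAlgebra ℂ M => a.coeff.sum fun m c => MonoidAlgebra.single (s m) (conj c))
    (InverseMonoidAlgebra.st_mul h1 h2 h3 fun _ => rfl)
    (InverseMonoidAlgebra.st_st h1 h2 h3 fun _ => rfl) fun a h => ?_
  by_contra ha
  exact InverseMonoidAlgebra.star_mul_self_ne_zero h1 h2 h3 ha h

end Steinberg2016_9_4_complex_proof

end Literature.RepresentationTheory.FiniteMonoids
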